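import Summits.AtomisticToContinuum.HydrodynamicLimit.Theses.ImplosionDichotomy
import Summits.AtomisticToContinuum.HydrodynamicLimit.Theorems.PolynomialCompression.Negative.PdeForm
import Summits.AtomisticToContinuum.HydrodynamicLimit.Theorems.PolynomialCompression.Negative.Statics
import Summits.AtomisticToContinuum.HydrodynamicLimit.Theorems.DenseExcursion.Negative.Dichotomy
import HarnessLib

/-!
# `HydroLimitInBand` (crux stmt-AtomisticToContinuum-9133), negative side: THE VACUOUS REGIME `σ³ ≥ η₀`

Standing disprover's lemma (`Cruxes/HydroLimitInBand/Disproof.lean` §4, refuter-cdisprove-stmt-AtomisticToContinuum-9133-0).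
In the crux `∃ η₀ > 0, ∀ profiles, ∃ σ₀, ∀ σ < σ₀, ∀ classical solutions with packing ρ_t(x)σ³ < η₀, tie at t = 0 ⇒ LLN at
every t`, the two hypotheses TIE + GUARD already force `σ³ < η₀`: data pinning (`PolynomialCompressionPDE.admissible_iff_data`)
makes `ρ 0 = rhoLim`, which has unit mass (`PolynomialCompressionStatics.integral_rhoLim_eq_one`), hence is `≥ 1` somewhere,
and the guard at that point reads `σ³ ≤ ρ 0 x σ³ < η₀`. Consequently, below the statics threshold, every `σ` with
`η₀ ≤ σ³` satisfies the inner implication of the crux VACUOUSLY (`inner_holds_of_le_sigma_cube`): the `∃ σ₀` of the crux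
carries content only for `σ < min(σ_statics, η₀^{1/3})`, and a prover may shrink `σ₀` there without loss.

* `exists_integral_le` — a continuous function on `𝕋³` is somewhere at least its mean;
* `sigma_cube_lt_of_guard` — tie + guard at `t = 0` ⇒ `σ³ < η₀`;
* `inner_holds_of_le_sigma_cube` — the regime `η₀ ≤ σ³` of the crux is vacuous-true.
-/

noncomputable section

open MeasureTheory Filter Set Topology
open scoped ENNReal

namespace Summit.AtomisticToContinuum.HydrodynamicLimit.Theorems

open Literature.MathematicalPhysics.KineticTheory Literature.Analysis.FluidPDE
open Literature.Analysis.FunctionSpaces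
open PolynomialCompressionPDE (Flows admissible_iff_data continuous_slices_zero)

namespace HydroLimitInBandNegative

/-- On `𝕋³` (Haar probability measure) a continuous function takes a value at least its mean. [folklore] -/
theorem exists_integral_le {f : T3 → ℝ} (hf : Continuous f) : ∃ x, ∫ y, f y ≤ f x := by
  haveI : IsProbabilityMeasure (volume : Measure T3) := by
    rw [volume_pi]; infer_instance
  obtain ⟨x₀, -, hx₀⟩ := isCompact_univ.exists_isMaxOn univ_nonempty hf.continuousOn
  refine ⟨x₀, ?_⟩
  calc ∫ y, f y ≤ ∫ _ : T3, f x₀ :=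
        integral_mono (integrable_of_continuous_T3 hf) (integrable_const _) fun y => hx₀ (mem_univ y)
    _ = f x₀ := by simp

/-- **Tie + guard at `t = 0` force `σ³ < η₀`.** Below the statics threshold `σ₁(a₀, θ₀, u₀)` of data pinning:
if fields with continuous time-`0` slices are tied at `t = 0` to the local Gibbs laws through some flow family
and satisfy the packing guard at `t = 0`, then `σ³ < η₀` — the pinned density `rhoLim` has unit mass, so it
is `≥ 1` somewhere. [folklore] -/
theorem sigma_cube_lt_of_guard {a₀ θ₀ : T3 → ℝ} {u₀ : T3 → V3} (ha : Continuous a₀) (hθ : Continuous θ₀)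
    (hu : Continuous u₀) (ha0 : ∀ x, 0 < a₀ x) (hθ0 : ∀ x, 0 < θ₀ x) :
    ∃ σ₁ : ℝ, 0 < σ₁ ∧ σ₁ ≤ 1 / 2 ∧ ∀ σ : ℝ, 0 < σ → σ < σ₁ →
      ∀ (η₀ : ℝ) (ρ θ : ℝ → T3 → ℝ) (u : ℝ → T3 → V3), Continuous (ρ 0) → Continuous (u 0) →
        Continuous (θ 0) → ∀ Φ : Flows σ,
        TendstoHydroFieldsAt (fun N => localGibbsLaw σ a₀ u₀ θ₀ N (Φ N)) Φ ρ u θ 0 →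
        (∀ x, ρ 0 x * σ ^ 3 < η₀) → σ ^ 3 < η₀ := by
  obtain ⟨σ₁, hσ₁, hσ₁2, A⟩ := admissible_iff_data ha hθ hu ha0 hθ0
  refine ⟨σ₁, hσ₁, hσ₁2, fun σ hσ hσlt η₀ ρ θ u hρc huc hθc Φ h0 hguard => ?_⟩
  obtain ⟨hsd, A'⟩ := A σ hσ hσlt
  obtain ⟨h1, -, -⟩ := (A' ρ θ u hρc huc hθc).1 fun Ψ =>
    DenseExcursionDichotomy.tendstoHydroFieldsAt_zero_transfer Φ Ψ h0
  obtain ⟨x₀, hx₀⟩ := exists_integral_le hsd.continuous_rhoLim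
  rw [PolynomialCompressionStatics.integral_rhoLim_eq_one hsd] at hx₀
  have hg := hguard x₀
  rw [h1] at hg
  have hσ3 : 0 ≤ σ ^ 3 := by positivity
  nlinarith

/-- **The regime `σ³ ≥ η₀` of the crux is vacuous.** Below the statics threshold, for `σ` with `η₀ ≤ σ³` the
inner implication of `HydroLimitInBand` holds trivially for EVERY solution class contained in
"continuous time-`0` slices when `T > 0`" — in particular for `IsHardSphereEulerSolution`: the hypotheses tie +
guard cannot both hold. Consequence for provers: WLOG `σ₀ ≤ min (σ_statics) (η₀^{1/3})`; the `∃ σ₀` of the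
crux carries content only there. [folklore] -/
theorem inner_holds_of_le_sigma_cube {a₀ θ₀ : T3 → ℝ} {u₀ : T3 → V3} (ha : Continuous a₀) (hθ : Continuous θ₀)
    (hu : Continuous u₀) (ha0 : ∀ x, 0 < a₀ x) (hθ0 : ∀ x, 0 < θ₀ x) :
    ∃ σ₁ : ℝ, 0 < σ₁ ∧ ∀ σ : ℝ, 0 < σ → σ < σ₁ → ∀ η₀ : ℝ, η₀ ≤ σ ^ 3 →
      ∀ (T : ℝ) (ρ θ : ℝ → T3 → ℝ) (u : ℝ → T3 → V3), IsHardSphereEulerSolution σ T ρ u θ →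
        (∀ t ∈ Ico 0 T, ∀ x, ρ t x * σ ^ 3 < η₀) →
        ∀ Φ : Flows σ, TendstoHydroFieldsAt (fun N => localGibbsLaw σ a₀ u₀ θ₀ N (Φ N)) Φ ρ u θ 0 →
        ∀ t ∈ Ico 0 T, TendstoHydroFieldsAt (fun N => localGibbsLaw σ a₀ u₀ θ₀ N (Φ N)) Φ ρ u θ t := by
  obtain ⟨σ₁, hσ₁, -, S⟩ := sigma_cube_lt_of_guard ha hθ hu ha0 hθ0
  refine ⟨σ₁, hσ₁, fun σ hσ hσlt η₀ hle T ρ θ u hE hguard Φ h0 t ht => ?_⟩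
  exfalso
  have hT : 0 < T := ht.1.trans_lt ht.2
  obtain ⟨hρc, huc, hθc⟩ := continuous_slices_zero hE hT
  have := S σ hσ hσlt η₀ ρ θ u hρc huc hθc Φ h0 (hguard 0 ⟨le_rfl, hT⟩)
  linarith


end HydroLimitInBandNegative

end Summit.AtomisticToContinuum.HydrodynamicLimit.Theorems

end
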